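import Literature.NumberTheory.DiophantineGeometry.AbcWave0GranvilleStarkTheorem1HilbertKummerProofs
import Literature.NumberTheory.NumberFields.UnramifiedDiscriminant
import HarnessLib

/-!
# Granville–Stark, Theorem 1 (abc.S22, `granville_stark`): the remaining input in Mathlib's
# ramification language — an unramified extension of `K` carrying `j(τ_D)` as a cube / square radicand

Topic `Literature/NumberTheory/DiophantineGeometry`; proofs-only companion (theorems only, no
definitions, no named facts) of the named fact
`Literature.NumberTheory.DiophantineGeometry.granville_stark` (A. Granville, H. M. Stark, *ABC implies
no "Siegel zeros" for `L`-functions of characters with negative discriminant*, Invent. Math. 139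
(2000), Theorem 1).

`granville_stark_of_hilbert_cubeSquare` (`…HilbertKummerProofs.lean`) needs, over every imaginary
quadratic `K` with `|d_K|` large, a number field `L` of root discriminant `≤ B√|d_K|` carrying an
algebraic integer `j₀` over `j(τ_{d_K})` with `(j₀)` a cube and `(j₀ − 1728)` a square.  Here the
discriminant condition is replaced by the STRUCTURAL one of the printed source — `L ⊇ K` unramified
at all finite primes (as the Hilbert class field `K(j(τ_D))` is: Cox, *Primes of the form x² + ny²*,
Thm. 11.1, "`K(j(𝔞))` is the Hilbert class field of `K`", with §5.C/§8.A: the Hilbert class field is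
the maximal unramified abelian extension) — using the proved
`Literature.NumberTheory.NumberFields.natAbs_discr_eq_pow_of_forall_isUnramifiedAt`
(`|d_L| = |d_K|^{[L:K]} = (√|d_K|)^{[L:ℚ]}`, Neukirch III (2.6), (2.9), (2.10)):

* `granville_stark_of_unramified_cubeSquare` : `granville_stark` follows from: `∃ d₁, ∀ K` imaginary
  quadratic with `|d_K| ≥ d₁`, `∃` a number field `L ⊇ K`, unramified over `𝓞_K` at every maximal
  ideal (`Algebra.IsUnramifiedAt`), a complex embedding `σ` of `L`, `j₀ ∈ 𝓞_L` with
  `σ(j₀) = j(τ_{d_K})`, and ideals `𝔞, 𝔟` with `(j₀) = 𝔞³`, `(j₀ − 1728) = 𝔟²`.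

With `L = K(j(τ_D))` the hypothesis consists of exactly two classical theorems of complex
multiplication, both still absent from Mathlib and the tree and NOT restated here as named facts
(D-0026): (U) `K(j(τ_D))/K` is unramified (Cox Thm. 11.1); (C) `(j(τ_D)) = 𝔞³` and
`(j(τ_D) − 1728) = 𝔟²` in `K(j(τ_D))` for `|d_K| > 4` (the ideal-theoretic content of Weber's theorem
on `γ₂ = ∛j`, `γ₃ = √(j − 1728)`, Cox Thm. 12.2 and §12.B; equivalently inertia acts on CM curves
through `μ(𝓞_K) = {±1}`, Silverman, *Advanced Topics*, II §5 and V §3–4).  Granville–Stark's own route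
(Lemma 1: `γ₂, γ₃` in the ray class field of conductor `6`, conductor–discriminant formula) is thereby
replaced by (U) + (C) + the proved Kummer and different computations of the tree.

## References

* A. Granville, H. M. Stark, Invent. Math. 139 (2000) 509–523: §2 (Lemma 1, proof of Theorem 1).
  [GranvilleStark2000]
* D. A. Cox, *Primes of the form x² + ny²*, 2nd ed. (2013): §5.C, §8.A, Thm. 11.1, Thm. 12.2.
  [Cox2013]
* J. Neukirch, *Algebraic Number Theory* (1999), Ch. III (2.6), (2.9), (2.10). [NeukirchANT1999]
-/

noncomputable section

open NumberField Module

namespace Literature.NumberTheory.DiophantineGeometry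

open Literature.NumberTheory.NumberFields Literature.NumberTheory.EllipticCurves
  Literature.NumberTheory.QuadraticFields.BinaryQuadraticForm

/-- **Granville–Stark, Theorem 1, from an unramified extension carrying the cube/square structure of
`j(τ_D)`** (the Hilbert class field input of Lemma 1 in Mathlib's ramification language): if for every
imaginary quadratic `K` with `|d_K| ≥ d₁` there is a number field `L ⊇ K`, unramified over `𝓞_K` at
all maximal ideals, with a complex embedding `σ`, `j₀ ∈ 𝓞_L` over the singular modulus `j(τ_{d_K})` of
the principal class, `(j₀) = 𝔞³` and `(j₀ − 1728) = 𝔟²`, then uniform `abc` gives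
`h(−d) ≥ (π/3 − δ)√d/log d` for `d ≥ d₀(δ)` (`granville_stark`).  Proof: `|d_L| = |d_K|^{[L:K]}`
(`natAbs_discr_eq_pow_of_forall_isUnramifiedAt`) is `(√|d_K|)^{[L:ℚ]}` since `[L:ℚ] = 2[L:K]`, so
`granville_stark_of_hilbert_cubeSquare` applies with `B = 1`.
[cite: GranvilleStark2000, §2 Lemma 1 and proof of Theorem 1] [cite: Cox2013, §11.A Thm. 11.1 and §12.A Thm. 12.2] -/
theorem granville_stark_of_unramified_cubeSquare
    (H : ∃ d₁ : ℝ, ∀ (K : Type) [Field K] [NumberField K],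
      Module.finrank ℚ K = 2 → NumberField.InfinitePlace.nrRealPlaces K = 0 →
      d₁ ≤ |(NumberField.discr K : ℝ)| →
        ∃ (L : Type) (_ : Field L) (_ : NumberField L) (_ : Algebra K L) (σ : L →+* ℂ) (j₀ : 𝓞 L)
          (𝔞 𝔟 : Ideal (𝓞 L)),
          σ j₀ = formJ (principalForm (NumberField.discr K)) ∧
          (∀ (P : Ideal (𝓞 L)) [P.IsMaximal], Algebra.IsUnramifiedAt (𝓞 K) P) ∧
          Ideal.span {j₀} = 𝔞 ^ 3 ∧ Ideal.span {j₀ - 1728} = 𝔟 ^ 2) :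
    granville_stark := by
  obtain ⟨d₁, hH⟩ := H
  refine granville_stark_of_hilbert_cubeSquare ⟨1, d₁, fun K _ _ h2 h0 hd ↦ ?_⟩
  obtain ⟨L, instF, instNF, instA, σ, j₀, 𝔞, 𝔟, hσ, hunr, h𝔞, h𝔟⟩ := hH K h2 h0 hd
  refine ⟨L, instF, instNF, σ, j₀, 𝔞, 𝔟, hσ, h𝔞, h𝔟, le_of_eq ?_⟩
  have hdisc := natAbs_discr_eq_pow_of_forall_isUnramifiedAt (K := K) (L := L) hunr
  haveI : Module.Free ℚ K := Module.Free.of_divisionRing ℚ K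
  haveI : Module.Free K L := Module.Free.of_divisionRing K L
  have hdeg : Module.finrank ℚ L = 2 * Module.finrank K L := by
    rw [← h2, Module.finrank_mul_finrank]
  have h1 : |(NumberField.discr L : ℝ)| = ((NumberField.discr L).natAbs : ℝ) := by
    rw [← Int.cast_abs, Int.abs_eq_natAbs, Int.cast_natCast]
  have h2' : |(NumberField.discr K : ℝ)| = ((NumberField.discr K).natAbs : ℝ) := by
    rw [← Int.cast_abs, Int.abs_eq_natAbs, Int.cast_natCast]
  rw [one_mul, hdeg, pow_mul, Real.sq_sqrt (abs_nonneg _), h1, hdisc, h2']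
  push_cast
  ring

end Literature.NumberTheory.DiophantineGeometry

end
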